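import Literature.Analysis.PDE.SemilinearHeatMild
import HarnessLib

/-!
# Crux `MixingPayoff` (stmt-NavierStokesRegularity-1422), line `birth`, stub W2
  (`stub_advectionDiffusionSchwartz`): tools for the explicit-time mild existence theorem

Helper file (lands `--supports stmt-NavierStokesRegularity-1422`): the closedness of the set of
admissible pair fields in `ℓ^∞` (the complete metric space of the contraction argument of the
tree's `Literature.Analysis.PDE.SemilinearHeat.exists_mild_solution`, Taylor *PDE III* Ch. 15
§1 Prop. 1.1), and the arithmetic of the smallness constant
`δ = min (1/(4c(Lf+1))) (1/(2cM+1))`.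
-/

noncomputable section

open MeasureTheory Set Function Filter Metric Real
open _root_.Topology
open scoped ENNReal NNReal ContDiff

-- `Summit = Problem` for this summit; the tree lakefile sets `weak.linter.dupNamespace = false`.
set_option linter.dupNamespace false

namespace Summit.NavierStokesRegularity.NavierStokesRegularity.Theorems.SelfMixingDichotomy.MixingPayoffBirth

open Literature.Analysis.UnboundedOperators Literature.Analysis.UnboundedOperators.HeatHolder
open Literature.Analysis.FluidPDE Literature.Analysis.PDE.SemilinearHeat

-- nested operator types `E →L[ℝ] E →L[ℝ] V`
set_option maxSynthPendingDepth 3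

variable {E : Type*} [NormedAddCommGroup E] [InnerProductSpace ℝ E] [FiniteDimensional ℝ E]
  [MeasurableSpace E] [BorelSpace E]
variable {V : Type*} [NormedAddCommGroup V] [NormedSpace ℝ V] [CompleteSpace V]

omit [FiniteDimensional ℝ E] [BorelSpace E] [CompleteSpace V] in
/-- **The admissible pair fields form a closed subset of `ℓ^∞(ℝ × E; V × (E →L V))`**: pairs
`(u, q)` bounded by `R`, jointly measurable, with continuous slices, `C¹` graphs `q = ∂u` on
`(0, T]`, vanishing off `(0, T]` (uniform limits; `hasFDerivAt_of_tendstoUniformly`). This is the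
closedness step of the tree's `SemilinearHeat.exists_mild_solution`, isolated. -/
theorem isClosed_admissible (R T : ℝ) :
    IsClosed {Φ : lp (fun _ : ℝ × E => V × (E →L[ℝ] V)) ∞ |
      (∀ p, ‖Φ p‖ ≤ R) ∧ StronglyMeasurable (⇑Φ : ℝ × E → V × (E →L[ℝ] V)) ∧
      (∀ s, Continuous fun y => Φ (s, y)) ∧
      (∀ t ∈ Ioc 0 T, ∀ x, HasFDerivAt (fun y => (Φ (t, y)).1) ((Φ (t, x)).2) x) ∧
      ∀ p : ℝ × E, p.1 ∉ Ioc 0 T → Φ p = 0} := by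
  have heval : ∀ (Φ Ψ : lp (fun _ : ℝ × E => V × (E →L[ℝ] V)) ∞) (q : ℝ × E),
      ‖Φ q - Ψ q‖ ≤ ‖Φ - Ψ‖ := by
    intro Φ Ψ q
    rw [← Pi.sub_apply, ← lp.coeFn_sub]
    exact lp.norm_apply_le_norm ENNReal.top_ne_zero _ q
  refine isSeqClosed_iff_isClosed.1 fun Φn Φ hΦn hlim => ?_
  have hunif : TendstoUniformly (fun n p => Φn n p) (⇑Φ) atTop := by
    rw [Metric.tendstoUniformly_iff]
    intro ε hε
    have h := (tendsto_iff_norm_sub_tendsto_zero.1 hlim).eventually (gt_mem_nhds hε)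
    filter_upwards [h] with n hn p
    rw [dist_eq_norm, ← norm_neg, neg_sub]
    exact (heval (Φn n) Φ p).trans_lt hn
  have hpt : ∀ p, Tendsto (fun n => Φn n p) atTop (𝓝 (Φ p)) := hunif.tendsto_at
  have hA := fun n => hΦn n
  refine ⟨?_, ?_, ?_, ?_, ?_⟩
  · intro p
    exact le_of_tendsto ((continuous_norm.tendsto _).comp (hpt p))
      (Eventually.of_forall fun n => (hA n).1 p)
  · exact stronglyMeasurable_of_tendsto atTop (fun n => (hA n).2.1) (tendsto_pi_nhds.2 hpt)
  · intro s
    have hu : TendstoUniformly (fun n y => Φn n (s, y)) (fun y => Φ (s, y)) atTop :=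
      hunif.comp fun y => (s, y)
    exact hu.continuous (Eventually.of_forall fun n => (hA n).2.2.1 s).frequently
  · intro t ht x
    have hu : TendstoUniformly (fun n y => Φn n (t, y)) (fun y => Φ (t, y)) atTop :=
      hunif.comp fun y => (t, y)
    have hu2 : TendstoUniformly (fun n y => (Φn n (t, y)).2) (fun y => (Φ (t, y)).2) atTop := by
      rw [Metric.tendstoUniformly_iff] at hu ⊢
      intro ε hε
      filter_upwards [hu ε hε] with n hn y
      refine lt_of_le_of_lt ?_ (hn y)
      rw [dist_eq_norm, dist_eq_norm, ← Prod.snd_sub]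
      exact norm_snd_le _
    have hpt1 : ∀ y, Tendsto (fun n => (Φn n (t, y)).1) atTop (𝓝 (Φ (t, y)).1) :=
      fun y => (continuous_fst.tendsto _).comp (hpt (t, y))
    exact hasFDerivAt_of_tendstoUniformly hu2 (fun n y => (hA n).2.2.2.1 t ht y) hpt1 x
  · intro p hp
    have h0 : (fun n => Φn n p) = fun _ => 0 := funext fun n => (hA n).2.2.2.2 p hp
    have h := hpt p
    rw [h0] at h
    exact tendsto_nhds_unique h tendsto_const_nhds


omit [FiniteDimensional ℝ E] [MeasurableSpace E] [BorelSpace E] in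
/-- **Arithmetic of the smallness constant** `δ = min (1/(4c(Lf+1))) (1/(2cM+1))` of the
contraction argument (`c ≥ 1`, `M, Lf ≥ 0`): `0 < δ ≤ 1`, `2cMδ ≤ 1`, `Mδ ≤ 1`, `2cLfδ ≤ 1/2`,
`Lfδ ≤ 1/2`. -/
theorem smallness_constants {c M Lf δ : ℝ} (hc1 : 1 ≤ c) (hM : 0 ≤ M) (hLf : 0 ≤ Lf)
    (hδ : δ = min (1 / (4 * c * (Lf + 1))) (1 / (2 * c * M + 1))) :
    0 < δ ∧ δ ≤ 1 ∧ 2 * c * M * δ ≤ 1 ∧ M * δ ≤ 1 ∧ 2 * c * Lf * δ ≤ 1 / 2 ∧ Lf * δ ≤ 1 / 2 := by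
  have hc0 : 0 < c := by linarith
  have hδ0 : 0 < δ := by rw [hδ]; exact lt_min (by positivity) (by positivity)
  have hδ1 : δ ≤ 1 / (4 * c * (Lf + 1)) := by rw [hδ]; exact min_le_left _ _
  have hδ2 : δ ≤ 1 / (2 * c * M + 1) := by rw [hδ]; exact min_le_right _ _
  have hδle : δ ≤ 1 := by
    refine hδ1.trans ?_
    rw [div_le_one (by positivity)]
    nlinarith
  have hsmallM : 2 * c * M * δ ≤ 1 := by
    have h := mul_le_mul_of_nonneg_left hδ2 (by positivity : 0 ≤ 2 * c * M)
    rw [mul_one_div] at h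
    exact h.trans ((div_le_one (by positivity)).2 (by linarith))
  have hsmallM' : M * δ ≤ 1 := by
    have : M * δ ≤ 2 * c * M * δ := by nlinarith [mul_nonneg hM hδ0.le]
    exact this.trans hsmallM
  have hsmallL : 2 * c * Lf * δ ≤ 1 / 2 := by
    have h := mul_le_mul_of_nonneg_left hδ1 (by positivity : 0 ≤ 2 * c * Lf)
    rw [mul_one_div] at h
    refine h.trans ?_
    rw [div_le_iff₀ (by positivity)]
    nlinarith
  have hsmallL' : Lf * δ ≤ 1 / 2 := by
    have : Lf * δ ≤ 2 * c * Lf * δ := by nlinarith [mul_nonneg hLf hδ0.le]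
    exact this.trans hsmallL
  exact ⟨hδ0, hδle, hsmallM, hsmallM', hsmallL, hsmallL'⟩

/-- Anchor (registered sub-stub of stub W2): the smallness arithmetic in closed form. -/
theorem w2aux_smallnessConstants : ∀ (c M Lf δ : ℝ), 1 ≤ c → 0 ≤ M → 0 ≤ Lf →
    δ = min (1 / (4 * c * (Lf + 1))) (1 / (2 * c * M + 1)) →
    0 < δ ∧ δ ≤ 1 ∧ 2 * c * M * δ ≤ 1 ∧ M * δ ≤ 1 ∧ 2 * c * Lf * δ ≤ 1 / 2 ∧ Lf * δ ≤ 1 / 2 :=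
  fun _ _ _ _ h1 h2 h3 h4 => smallness_constants h1 h2 h3 h4

end Summit.NavierStokesRegularity.NavierStokesRegularity.Theorems.SelfMixingDichotomy.MixingPayoffBirth

end
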